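import Summits.BirchSwinnertonDyer.BirchSwinnertonDyer.Theorems.QuadraticBranchSignedControlPlusEtaNonsurjBDMTVPrimes
import Summits.BirchSwinnertonDyer.BirchSwinnertonDyer.Theorems.QuadraticBranchSignedControlPlusEtaNonsurjUncongruentRecordsEleven03
import HarnessLib

/-!
# Route `QuadraticBranchSignedControl` (rung K8, cell `bsd-potss`): crux stmt-BirchSwinnertonDyer-19606
# `PlusEtaMainConjectureNonsurj` — REFERENCE ROWS AT THE BDMTV PRIMES: each of the seven CM `j`-classes at `p = 13` and at `p = 17`
# OCCURS on a row (kernel), so the `j`-set of the rows is EXACTLY the seven-element set (`#X_ns⁺(13)(ℚ) = #X_ns⁺(17)(ℚ) = 7`, moduli form)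

WHAT. The sibling file `…PlusEtaNonsurjBDMTVPrimes` (k8eta-c2 g17) proves: GIVEN the BDMTV CM-ness theorems (named facts
`BDMTV2019_nonsplitCartan_level13` / `BDMTV2023_nonsplitCartan_level17`), every row of crux 19606 at `p = 13` (resp. `17`) — `V/ℚ` globally
minimal, good at `p`, `a_p = 0`, `p`-adic tower not onto — has `j(V)` in an explicit seven-element set of CM `j`-invariants. Here the converse,
with NO named fact: for each of the seven `j₀` a reference curve of Cremona's table is certified in the kernel to BE a row — `Δ ≠ 0`, global
minimality (Kraus/Silverman on the support of `Δ`), `p ∤ Δ` and `#E(𝔽_p) = p + 1` (so good at `p` with `a_p = 0`, `good_and_frobeniusTrace_eq_of_countPoints`),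
`j = j₀ ∈ cmJInvariants` (so CM, `hasCM_iff_j_mem_holds`), hence `ρ̄_{V,p}` not onto (Zywina, `not_hasSurjectiveModNGaloisRep_of_hasCM`):

* `p = 13`: `49a1 = [1,−1,0,−2,−1]` (`j = −3375`), `49a3 = [1,−1,0,−37,−78]` (`16581375`), `[0,4,0,2,0]` (`8000`, conductor `256`),
  `121b1 = [0,−1,1,−7,10]` (`−32768`), `361a1 = [0,0,1,−38,90]` (`−884736`), `4489a1 = [0,0,1,−7370,243528]` (`−147197952000`),
  `26569a1 = [0,0,1,−2174420,1234136692]` (`−262537412640768000`) — `#E(𝔽₁₃) = 14` each;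
* `p = 17`: `27a3 = [0,0,1,0,0]` (`j = 0`), `36a2 = [0,0,0,−15,22]` (`54000`), `27a4 = [0,0,1,−30,63]` (`−12288000`), `49a1`, `49a3`, `121b1`,
  `26569a1` — `#E(𝔽₁₇) = 18` each.

Hence `rows_thirteen_j_iff` / `rows_seventeen_j_iff`: GIVEN the BDMTV fact, **`j₀` is the `j`-invariant of a row of 19606 at `13` (resp. `17`)
iff `j₀` lies in the seven-element set** — the moduli form of BDMTV's `#X_ns⁺(13)(ℚ) = 7` (discriminants `−7, −8, −11, −19, −28, −67, −163`)
and `#X_ns⁺(17)(ℚ) = 7` (`−3, −7, −11, −12, −27, −28, −163`), whose count was left `-- TODO(general form)` in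
`Literature/NumberTheory/SerreUniformity/Statement.lean`: the COUNT is kernel arithmetic once CM-ness is granted (Deuring inertness
`cmInert_of_cmAnchor` + the 13-entry CM table). Certificates of `49a1, 49a3, [0,4,0,2,0], 4489a1, 26569a1` (k8eta-c2 g14 `…UncongruentFineTools`),
`121b1` (`X10.CMPartnerCurves`, `j` in `…UncongruentSevenTools`), `36a2` (g16 `…UncongruentRecordsEleven03`), `27a4` (Literature `isElliptic_curve27a4` /
`j_curve27a4`, `P2.TwentySevenA4`) are REUSED; `361a1` and `27a3` (as a `ℚ`-literal) are certified here.

HONEST FRAMING (cell `bsd-potss`, run/shared/lean/pub/bsd-potss/; FULL-BSD rank ≤ 1 programme): reference-curve certificates and two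
bookkeeping equivalences; no definition, no new named fact, no `sorry`, axioms standard. Nothing about (C1⁺_η) at these rows is proved;
crux 19606 stays OPEN; `BSD(W, p)` is claimed for no pair. Seat `bsd-potss-k8eta-c2` g17 (prover), `--supports stmt-BirchSwinnertonDyer-19606`.

References: [BalakrishnanEtAl2019] Cor. 1.3; [BalakrishnanEtAl2023] Thm. 1.2; [Cremona1997] Table 1 (27a3, 27a4, 36a2, 49a1, 49a3, 121b1,
361a1, 4489a1, 26569a1); [SilvermanAEC2009] VII.1 Rem. 1.1, VII.5 Prop. 5.1; [SilvermanAdvancedTopics1994] App. A §3; [Zywina2015] Prop. 1.14.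
-/

set_option autoImplicit false
set_option linter.dupNamespace false

noncomputable section

open scoped Classical

open WeierstrassCurve Literature.NumberTheory.EllipticCurves Literature.NumberTheory.EllipticCurves.Rank1Residual
  Literature.NumberTheory.EllipticCurves.Rank1Residual.X11RankOneCertificates Literature.NumberTheory.SerreUniformity
  Summit.BirchSwinnertonDyer.Rank1Residual.X11b Summit.BirchSwinnertonDyer.BirchSwinnertonDyer.Rank1Residual.IntModel
  Summit.BirchSwinnertonDyer.BirchSwinnertonDyer.Rank1Residual.X11RankOne
open Summit.BirchSwinnertonDyer.Rank1Residual.X10.CMPartnerCurves (isElliptic_cm121b1 isGloballyMinimal_cm121b1)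

namespace Summit.BirchSwinnertonDyer.BirchSwinnertonDyer.Theorems.EtaBDMTVPrimes

open Summit.BirchSwinnertonDyer.BirchSwinnertonDyer.Theorems.EtaCartanField
open Summit.BirchSwinnertonDyer.BirchSwinnertonDyer.Theorems.EtaUncongruentRecords
open Summit.BirchSwinnertonDyer.BirchSwinnertonDyer.Theorems.EtaUncongruentRecordsSeven
open Summit.BirchSwinnertonDyer.BirchSwinnertonDyer.Theorems.EtaUncongruentRecordsEleven

/-! ## §1 Row conditions from counts; two new reference curves -/

/-- **Row conditions from counts, for a CM integer model.** `V` globally minimal with integral model `[a₁,…,a₆]`, `p` odd with `p ∤ Δ`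
and `#E(𝔽_p) = p + 1`, `j(V)` a CM `j`-invariant: `V` is good at `p`, `a_p(V) = 0`, its `p`-adic tower is NOT onto (a CM curve has
non-surjective `ρ̄_{V,p}` — Zywina) and `V` has CM. [cite: SilvermanAEC2009, VII.5 Prop. 5.1 (a) and V.2] [cite: Zywina2015, Prop. 1.14] -/
theorem row_of_counts_of_j_mem (V : WeierstrassCurve ℚ) [V.IsElliptic] [V.IsGloballyMinimal] (p : ℕ) [Fact p.Prime] (hp2 : p ≠ 2)
    {a1 a2 a3 a4 a6 : ℤ} (hI : integralModelInt V = ⟨a1, a2, a3, a4, a6⟩) (hΔ : ¬ (p : ℤ) ∣ discOf [a1, a2, a3, a4, a6])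
    (hc : countPoints [a1, a2, a3, a4, a6] p = (p : ℤ) + 1) (hj : V.j ∈ cmJInvariants) :
    V.HasGoodReductionAtPrime p ∧ V.frobeniusTrace p = 0 ∧ ¬ (∀ m : ℕ, V.HasSurjectiveModNGaloisRep (p ^ m : ℕ)) ∧ V.HasCM := by
  obtain ⟨hgood, htr⟩ := good_and_frobeniusTrace_eq_of_countPoints hI p hp2 hΔ
  have hCM : V.HasCM := (hasCM_iff_j_mem_holds V).mpr hj
  refine ⟨hgood, by rw [htr, hc]; ring, fun h => ?_, hCM⟩
  exact V.not_hasSurjectiveModNGaloisRep_of_hasCM hCM Fact.out hp2 (by simpa using h 1)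

/-- `361a1 = [0,0,1,−38,90]` (CM by `ℤ[(1+√−19)/2]`): `Δ = −19³ ≠ 0`. [cite: Cremona1997, Table 1 (361a1)] -/
theorem isElliptic_A19 : (⟨0, 0, 1, -38, 90⟩ : WeierstrassCurve ℚ).IsElliptic :=
  isElliptic_of_discOf_ne_zero 0 0 1 (-38) 90 (by decide +kernel)

/-- `361a1 = [0,0,1,−38,90]` is a global minimal equation (kernel, support `{19}` of `Δ`). [cite: Cremona1997, Table 1 (361a1)] -/
theorem isGloballyMinimal_A19 : (⟨0, 0, 1, -38, 90⟩ : WeierstrassCurve ℚ).IsGloballyMinimal :=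
  isGloballyMinimal_of_krausCriterion_support 0 0 1 (-38) 90 [(19, 2, 3)] (by decide +kernel) (by decide +kernel) (by decide +kernel)

/-- `j(361a1) = −884736 = −2¹⁵·3³`. [cite: SilvermanAdvancedTopics1994, App. A §3] -/
theorem j_A19 : @WeierstrassCurve.j ℚ _ ⟨0, 0, 1, -38, 90⟩ isElliptic_A19 = -884736 := by
  rw [@j_eq_c₄_pow_div _ isElliptic_A19]; norm_num [WeierstrassCurve.c₄, WeierstrassCurve.b₂, WeierstrassCurve.b₄,
    WeierstrassCurve.Δ, WeierstrassCurve.b₆, WeierstrassCurve.b₈]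

/-- `27a3 = [0,0,1,0,0]` (`y² + y = x³`, `j = 0`, CM by `ℤ[ζ₃]`): `Δ = −27 ≠ 0`. [cite: Cremona1997, Table 1 (27a3)] -/
theorem isElliptic_A3z : (⟨0, 0, 1, 0, 0⟩ : WeierstrassCurve ℚ).IsElliptic :=
  isElliptic_of_discOf_ne_zero 0 0 1 0 0 (by decide +kernel)

/-- `27a3 = [0,0,1,0,0]` is a global minimal equation (kernel, support `{3}` of `Δ`). [cite: Cremona1997, Table 1 (27a3)] -/
theorem isGloballyMinimal_A3z : (⟨0, 0, 1, 0, 0⟩ : WeierstrassCurve ℚ).IsGloballyMinimal :=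
  isGloballyMinimal_of_krausCriterion_support 0 0 1 0 0 [(3, 3, 3)] (by decide +kernel) (by decide +kernel) (by decide +kernel)

/-- `j(27a3) = 0`. [cite: SilvermanAdvancedTopics1994, App. A §3] -/
theorem j_A3z : @WeierstrassCurve.j ℚ _ ⟨0, 0, 1, 0, 0⟩ isElliptic_A3z = 0 := by
  rw [@j_eq_c₄_pow_div _ isElliptic_A3z]; norm_num [WeierstrassCurve.c₄, WeierstrassCurve.b₂, WeierstrassCurve.b₄]

/-! ## §2 `p = 13`: the seven classes occur; the `j`-set of the rows -/

/-- **Each of the seven classes at `p = 13` occurs on a row** (kernel, no BDMTV): for every `j₀` in the seven-element set there is a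
globally minimal elliptic `V/ℚ`, good at `13` with `a_13(V) = 0`, `13`-adic tower not onto, CM, with `j(V) = j₀` — the reference curves
`49a1, 49a3, [0,4,0,2,0], 121b1, 361a1, 4489a1, 26569a1`, each with `#E(𝔽₁₃) = 14` (kernel point count).
[cite: Cremona1997, Table 1] [cite: Zywina2015, Prop. 1.14] [cite: SilvermanAEC2009, VII.5 Prop. 5.1 (a)] -/
theorem exists_row_thirteen_of_mem_seven [Fact (13 : ℕ).Prime] (j₀ : ℚ)
    (hj₀ : j₀ ∈ ({-3375, 16581375, 8000, -32768, -884736, -147197952000, -262537412640768000} : Finset ℚ)) :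
    ∃ (V : WeierstrassCurve ℚ) (_ : V.IsElliptic) (_ : V.IsGloballyMinimal),
      V.HasGoodReductionAtPrime 13 ∧ V.frobeniusTrace 13 = 0 ∧ ¬ (∀ m : ℕ, V.HasSurjectiveModNGaloisRep (13 ^ m : ℕ)) ∧
        V.HasCM ∧ V.j = j₀ := by
  have h2 : (13 : ℕ) ≠ 2 := by decide
  simp only [Finset.mem_insert, Finset.mem_singleton] at hj₀
  rcases hj₀ with rfl | rfl | rfl | rfl | rfl | rfl | rfl
  · haveI := isElliptic_A7a
    haveI := Summit.BirchSwinnertonDyer.Rank1Residual.X12.O11.RouteU.isGloballyMinimal_X049_eq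
    have hI : integralModelInt (⟨1, -1, 0, -2, -1⟩ : WeierstrassCurve ℚ) = ⟨1, -1, 0, -2, -1⟩ :=
      integralModelInt_eq_of_map_eq _ (map_mk_int 1 (-1) 0 (-2) (-1))
    have hj := j_A7a
    obtain ⟨a, b, c, d⟩ := row_of_counts_of_j_mem _ 13 h2 hI (by decide +kernel) (by decide +kernel) (by rw [hj]; decide +kernel)
    exact ⟨_, ‹_›, ‹_›, a, b, c, d, hj⟩
  · haveI := isElliptic_A7b
    haveI := isGloballyMinimal_A7b
    have hI : integralModelInt (⟨1, -1, 0, -37, -78⟩ : WeierstrassCurve ℚ) = ⟨1, -1, 0, -37, -78⟩ :=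
      integralModelInt_eq_of_map_eq _ (map_mk_int 1 (-1) 0 (-37) (-78))
    have hj := j_A7b
    obtain ⟨a, b, c, d⟩ := row_of_counts_of_j_mem _ 13 h2 hI (by decide +kernel) (by decide +kernel) (by rw [hj]; decide +kernel)
    exact ⟨_, ‹_›, ‹_›, a, b, c, d, hj⟩
  · haveI := isElliptic_A8
    haveI := isGloballyMinimal_A8
    have hI : integralModelInt (⟨0, 4, 0, 2, 0⟩ : WeierstrassCurve ℚ) = ⟨0, 4, 0, 2, 0⟩ :=
      integralModelInt_eq_of_map_eq _ (map_mk_int 0 4 0 2 0)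
    have hj := j_A8
    obtain ⟨a, b, c, d⟩ := row_of_counts_of_j_mem _ 13 h2 hI (by decide +kernel) (by decide +kernel) (by rw [hj]; decide +kernel)
    exact ⟨_, ‹_›, ‹_›, a, b, c, d, hj⟩
  · haveI := isElliptic_cm121b1
    haveI := isGloballyMinimal_cm121b1
    have hI : integralModelInt (⟨0, -1, 1, -7, 10⟩ : WeierstrassCurve ℚ) = ⟨0, -1, 1, -7, 10⟩ :=
      integralModelInt_eq_of_map_eq _ (map_mk_int 0 (-1) 1 (-7) 10)
    have hj := j_A11
    obtain ⟨a, b, c, d⟩ := row_of_counts_of_j_mem _ 13 h2 hI (by decide +kernel) (by decide +kernel) (by rw [hj]; decide +kernel)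
    exact ⟨_, ‹_›, ‹_›, a, b, c, d, hj⟩
  · haveI := isElliptic_A19
    haveI := isGloballyMinimal_A19
    have hI : integralModelInt (⟨0, 0, 1, -38, 90⟩ : WeierstrassCurve ℚ) = ⟨0, 0, 1, -38, 90⟩ :=
      integralModelInt_eq_of_map_eq _ (map_mk_int 0 0 1 (-38) 90)
    have hj := j_A19
    obtain ⟨a, b, c, d⟩ := row_of_counts_of_j_mem _ 13 h2 hI (by decide +kernel) (by decide +kernel) (by rw [hj]; decide +kernel)
    exact ⟨_, ‹_›, ‹_›, a, b, c, d, hj⟩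
  · haveI := isElliptic_A67
    haveI := isGloballyMinimal_A67
    have hI : integralModelInt (⟨0, 0, 1, -7370, 243528⟩ : WeierstrassCurve ℚ) = ⟨0, 0, 1, -7370, 243528⟩ :=
      integralModelInt_eq_of_map_eq _ (map_mk_int 0 0 1 (-7370) 243528)
    have hj := j_A67
    obtain ⟨a, b, c, d⟩ := row_of_counts_of_j_mem _ 13 h2 hI (by decide +kernel) (by decide +kernel) (by rw [hj]; decide +kernel)
    exact ⟨_, ‹_›, ‹_›, a, b, c, d, hj⟩
  · haveI := isElliptic_A163
    haveI := isGloballyMinimal_A163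
    have hI : integralModelInt (⟨0, 0, 1, -2174420, 1234136692⟩ : WeierstrassCurve ℚ) = ⟨0, 0, 1, -2174420, 1234136692⟩ :=
      integralModelInt_eq_of_map_eq _ (map_mk_int 0 0 1 (-2174420) 1234136692)
    have hj := j_A163
    obtain ⟨a, b, c, d⟩ := row_of_counts_of_j_mem _ 13 h2 hI (by decide +kernel) (by decide +kernel) (by rw [hj]; decide +kernel)
    exact ⟨_, ‹_›, ‹_›, a, b, c, d, hj⟩

/-- **The `j`-set of the rows of crux 19606 at `p = 13` is EXACTLY `{−3375, 16581375, 8000, −32768, −884736, −147197952000,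
−262537412640768000}`** — GIVEN BDMTV 2019 Cor. 1.3 (named fact, hypothesis position) for «⊆» (sibling file, `j_mem_seven_of_row_thirteen`),
kernel certificates for «⊇». The moduli form of `#X_ns⁺(13)(ℚ) = 7` (seven CM points, discriminants `−7, −8, −11, −19, −28, −67, −163`).
[cite: BalakrishnanEtAl2019, Cor. 1.3] [cite: SilvermanAdvancedTopics1994, App. A §3] -/
theorem rows_thirteen_j_iff (h13 : BDMTV2019_nonsplitCartan_level13) [Fact (13 : ℕ).Prime] (j₀ : ℚ) :
    (∃ (V : WeierstrassCurve ℚ) (_ : V.IsElliptic) (_ : V.IsGloballyMinimal),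
      V.HasGoodReductionAtPrime 13 ∧ V.frobeniusTrace 13 = 0 ∧ ¬ (∀ m : ℕ, V.HasSurjectiveModNGaloisRep (13 ^ m : ℕ)) ∧ V.j = j₀) ↔
    j₀ ∈ ({-3375, 16581375, 8000, -32768, -884736, -147197952000, -262537412640768000} : Finset ℚ) := by
  constructor
  · rintro ⟨V, _, _, hgood, hap, hns, rfl⟩
    exact j_mem_seven_of_row_thirteen h13 V 13 rfl hgood hap hns
  · intro h
    obtain ⟨V, _, _, hgood, hap, hns, -, hj⟩ := exists_row_thirteen_of_mem_seven j₀ h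
    exact ⟨V, ‹_›, ‹_›, hgood, hap, hns, hj⟩

/-! ## §3 `p = 17`: the seven classes occur; the `j`-set of the rows -/

/-- **Each of the seven classes at `p = 17` occurs on a row** (kernel, no BDMTV): reference curves `27a3, 36a2, 27a4, 49a1, 49a3, 121b1,
26569a1`, each with `#E(𝔽₁₇) = 18`. [cite: Cremona1997, Table 1] [cite: Zywina2015, Prop. 1.14] [cite: SilvermanAEC2009, VII.5 Prop. 5.1 (a)] -/
theorem exists_row_seventeen_of_mem_seven [Fact (17 : ℕ).Prime] (j₀ : ℚ)
    (hj₀ : j₀ ∈ ({0, 54000, -12288000, -3375, 16581375, -32768, -262537412640768000} : Finset ℚ)) :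
    ∃ (V : WeierstrassCurve ℚ) (_ : V.IsElliptic) (_ : V.IsGloballyMinimal),
      V.HasGoodReductionAtPrime 17 ∧ V.frobeniusTrace 17 = 0 ∧ ¬ (∀ m : ℕ, V.HasSurjectiveModNGaloisRep (17 ^ m : ℕ)) ∧
        V.HasCM ∧ V.j = j₀ := by
  have h2 : (17 : ℕ) ≠ 2 := by decide
  simp only [Finset.mem_insert, Finset.mem_singleton] at hj₀
  rcases hj₀ with rfl | rfl | rfl | rfl | rfl | rfl | rfl
  · haveI := isElliptic_A3z
    haveI := isGloballyMinimal_A3z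
    have hI : integralModelInt (⟨0, 0, 1, 0, 0⟩ : WeierstrassCurve ℚ) = ⟨0, 0, 1, 0, 0⟩ :=
      integralModelInt_eq_of_map_eq _ (map_mk_int 0 0 1 0 0)
    have hj := j_A3z
    obtain ⟨a, b, c, d⟩ := row_of_counts_of_j_mem _ 17 h2 hI (by decide +kernel) (by decide +kernel) (by rw [hj]; decide +kernel)
    exact ⟨_, ‹_›, ‹_›, a, b, c, d, hj⟩
  · haveI := isElliptic_A3a
    haveI := isGloballyMinimal_A3a
    have hI : integralModelInt (⟨0, 0, 0, -15, 22⟩ : WeierstrassCurve ℚ) = ⟨0, 0, 0, -15, 22⟩ :=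
      integralModelInt_eq_of_map_eq _ (map_mk_int 0 0 0 (-15) 22)
    have hj := j_A3a
    obtain ⟨a, b, c, d⟩ := row_of_counts_of_j_mem _ 17 h2 hI (by decide +kernel) (by decide +kernel) (by rw [hj]; decide +kernel)
    exact ⟨_, ‹_›, ‹_›, a, b, c, d, hj⟩
  · haveI := isElliptic_curve27a4
    haveI := Summit.BirchSwinnertonDyer.Rank1Residual.P2.TwentySevenA4.isGloballyMinimal_curve27a4
    have hI : integralModelInt (⟨0, 0, 1, -30, 63⟩ : WeierstrassCurve ℚ) = ⟨0, 0, 1, -30, 63⟩ :=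
      integralModelInt_eq_of_map_eq _ (map_mk_int 0 0 1 (-30) 63)
    have hj : (⟨0, 0, 1, -30, 63⟩ : WeierstrassCurve ℚ).j = -12288000 := j_curve27a4
    obtain ⟨a, b, c, d⟩ := row_of_counts_of_j_mem _ 17 h2 hI (by decide +kernel) (by decide +kernel) (by rw [hj]; decide +kernel)
    exact ⟨_, ‹_›, ‹_›, a, b, c, d, hj⟩
  · haveI := isElliptic_A7a
    haveI := Summit.BirchSwinnertonDyer.Rank1Residual.X12.O11.RouteU.isGloballyMinimal_X049_eq
    have hI : integralModelInt (⟨1, -1, 0, -2, -1⟩ : WeierstrassCurve ℚ) = ⟨1, -1, 0, -2, -1⟩ :=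
      integralModelInt_eq_of_map_eq _ (map_mk_int 1 (-1) 0 (-2) (-1))
    have hj := j_A7a
    obtain ⟨a, b, c, d⟩ := row_of_counts_of_j_mem _ 17 h2 hI (by decide +kernel) (by decide +kernel) (by rw [hj]; decide +kernel)
    exact ⟨_, ‹_›, ‹_›, a, b, c, d, hj⟩
  · haveI := isElliptic_A7b
    haveI := isGloballyMinimal_A7b
    have hI : integralModelInt (⟨1, -1, 0, -37, -78⟩ : WeierstrassCurve ℚ) = ⟨1, -1, 0, -37, -78⟩ :=
      integralModelInt_eq_of_map_eq _ (map_mk_int 1 (-1) 0 (-37) (-78))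
    have hj := j_A7b
    obtain ⟨a, b, c, d⟩ := row_of_counts_of_j_mem _ 17 h2 hI (by decide +kernel) (by decide +kernel) (by rw [hj]; decide +kernel)
    exact ⟨_, ‹_›, ‹_›, a, b, c, d, hj⟩
  · haveI := isElliptic_cm121b1
    haveI := isGloballyMinimal_cm121b1
    have hI : integralModelInt (⟨0, -1, 1, -7, 10⟩ : WeierstrassCurve ℚ) = ⟨0, -1, 1, -7, 10⟩ :=
      integralModelInt_eq_of_map_eq _ (map_mk_int 0 (-1) 1 (-7) 10)
    have hj := j_A11
    obtain ⟨a, b, c, d⟩ := row_of_counts_of_j_mem _ 17 h2 hI (by decide +kernel) (by decide +kernel) (by rw [hj]; decide +kernel)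
    exact ⟨_, ‹_›, ‹_›, a, b, c, d, hj⟩
  · haveI := isElliptic_A163
    haveI := isGloballyMinimal_A163
    have hI : integralModelInt (⟨0, 0, 1, -2174420, 1234136692⟩ : WeierstrassCurve ℚ) = ⟨0, 0, 1, -2174420, 1234136692⟩ :=
      integralModelInt_eq_of_map_eq _ (map_mk_int 0 0 1 (-2174420) 1234136692)
    have hj := j_A163
    obtain ⟨a, b, c, d⟩ := row_of_counts_of_j_mem _ 17 h2 hI (by decide +kernel) (by decide +kernel) (by rw [hj]; decide +kernel)
    exact ⟨_, ‹_›, ‹_›, a, b, c, d, hj⟩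

/-- **The `j`-set of the rows of crux 19606 at `p = 17` is EXACTLY `{0, 54000, −12288000, −3375, 16581375, −32768,
−262537412640768000}`** — GIVEN BDMTV 2023 Thm. 1.2 (named fact) for «⊆», kernel certificates for «⊇». The moduli form of
`#X_ns⁺(17)(ℚ) = 7` (seven CM points, discriminants `−3, −7, −11, −12, −27, −28, −163`). [cite: BalakrishnanEtAl2023, Thm. 1.2]
[cite: SilvermanAdvancedTopics1994, App. A §3] -/
theorem rows_seventeen_j_iff (h17 : BDMTV2023_nonsplitCartan_level17) [Fact (17 : ℕ).Prime] (j₀ : ℚ) :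
    (∃ (V : WeierstrassCurve ℚ) (_ : V.IsElliptic) (_ : V.IsGloballyMinimal),
      V.HasGoodReductionAtPrime 17 ∧ V.frobeniusTrace 17 = 0 ∧ ¬ (∀ m : ℕ, V.HasSurjectiveModNGaloisRep (17 ^ m : ℕ)) ∧ V.j = j₀) ↔
    j₀ ∈ ({0, 54000, -12288000, -3375, 16581375, -32768, -262537412640768000} : Finset ℚ) := by
  constructor
  · rintro ⟨V, _, _, hgood, hap, hns, rfl⟩
    exact j_mem_seven_of_row_seventeen h17 V 17 rfl hgood hap hns
  · intro h
    obtain ⟨V, _, _, hgood, hap, hns, -, hj⟩ := exists_row_seventeen_of_mem_seven j₀ h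
    exact ⟨V, ‹_›, ‹_›, hgood, hap, hns, hj⟩

end Summit.BirchSwinnertonDyer.BirchSwinnertonDyer.Theorems.EtaBDMTVPrimes

end
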